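import Summits.Ventures.HSemireg.Mod4LeadingTermPins
import Summits.Ventures.HSemireg.Mod4MiddleKernelSplit

/-!
# Venture HSemireg — MOD-4 line: the `ch(O_Z)`-SHAPE rows at the pins for EVEN `n`: the drop is the geometric multiplicity of the
# double eigenvalue `μ_a = (−1)^a C(n,a) q_n` of the TRIANGULAR `T_f` (a problem linear in the tail), and the FOURFOLD criterion
# `n = 2`, pin `t = q₂²`: drop `2` iff `3q₂q₄ = 2q₃²`, else `1`

HONEST FRAMING. Part of the Lean index of the computation cell `pub-hsemireg` (seat w3-mod4-1 gen 14, W3 SPECIAL FIBRES; file of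
record `HOME/widen/W3/MOD4-OFFSPLIT-w3mod4.md` §8 TABLE R rows 1–2 at `n = 2`: «pure middle (1,8,22,8,1)» vs «`ch(O_Z)` generic
(1,8,23,8,1) at the same J», §13.25). ELEMENTARY LINEAR ALGEBRA over a field ONLY: no abelian variety, no sheaf, no Ext group, no
semiregularity map; nothing here says that HC / HC_CM / HC_AV holds; no Literature fact is declared; NO definition is introduced.

WHAT IS PROVED (`K` a field, `CharZero K`; `q_m = 0` for `m < n`, `q_n ≠ 0`; `a ≤ n`; `μ_a = (−1)^a C(n,a) q_n`, `t_a = (−1)ⁿ C(n,a)² q_n² = (−1)ⁿ μ_a²`):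
* **`hankelT_leading_diag_add_ne_zero_of_even`** — `n` even ⇒ `(−1)^b C(n,b) q_n + μ_a ≠ 0` for every `b ≤ n` (`−μ_a` is NOT a diagonal
  entry of `T_f`: equal binomials force `b ∈ {a, n−a}`, of the parity of `a`); hence **`ker_hankelT_add_pin_eq_bot_of_even`** —
  `ker(T_f + μ_a) = ⊥`, and by `Mod4MiddleKernelSplit` **`finrank_ker_middleM_leading_pin_even`** —
  `dim ker(M_f − t_a) = dim ker(T_f − μ_a)` (`∈ {1, 2}` by `Mod4LeadingTermPins`);
* **`finrank_ker_middleM_leading_two_pin_of_eq`** ∕ **`…_of_ne`** — `n = 2`, `q_0 = q_1 = 0`, `q_2 ≠ 0`, pin `t = q₂²` (`a = 0`):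
  `dim ker(M_f − t) = 2` if `3q₂q₄ = 2q₃²`, `= 1` otherwise (`T_f − q₂` has the rows `(0, −2q₃, q₄)`, `(0, −3q₂, q₃)`, `(0, 0, 0)`:
  `hankelT_two_sub_mulVec`; the `2 × 2` determinant is `3q₂q₄ − 2q₃²`).
So at `n = 2` the middle entry of a `ch(O_S)`-shape row on the real carrier is `22` at the pin `q₂²` iff `3q₂q₄ = 2q₃²` (the pure shape
`q₃ = q₄ = 0` included), else `23`; `23` at the self-dual pin `4q₂²`; `24` off the pins (`WeilFrameLeadingTermPins`, FILE 13) — §8's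
`22 ∕ 23` «at the same J» is this bit. Machine ×2: code A on six tails (`mod4g14/x2pins`). Everything PROVED, 0 sorry.
Namespace `Summit.Ventures.HSemireg.Mod4`.
References: [BourbakiAlgebre1a3] Ch. III §8; [BuchweitzFlenner2008HH] Prop. 6.4.4 (why these matrices).
-/

namespace Summit.Ventures.HSemireg.Mod4

open Finset Matrix

variable {K : Type*} [Field K]

/-- **for even `n`, `−μ_a` is not on the diagonal of `T_f`:** `(−1)^b C(n,b) q_n + (−1)^a C(n,a) q_n ≠ 0` for `a, b ≤ n`, `q_n ≠ 0`
(`CharZero K`). [cite: BourbakiAlgebre1a3, Ch. III §8] -/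
theorem hankelT_leading_diag_add_ne_zero_of_even [CharZero K] {n : ℕ} (hn : Even n) {q : ℕ → K} (hqn : q n ≠ 0)
    {a b : ℕ} (ha : a ≤ n) (hb : b ≤ n) :
    (-1 : K) ^ b * (n.choose b : K) * q n + (-1 : K) ^ a * (n.choose a : K) * q n ≠ 0 := by
  intro h
  have h1 : ((-1 : K) ^ b * (n.choose b : K) + (-1 : K) ^ a * (n.choose a : K)) * q n = 0 := by
    linear_combination h
  have h2 : (-1 : K) ^ b * (n.choose b : K) + (-1 : K) ^ a * (n.choose a : K) = 0 :=
    (mul_eq_zero.mp h1).resolve_right hqn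
  have hca : 0 < n.choose a := Nat.choose_pos ha
  rcases Nat.even_or_odd (a + b) with hab | hab
  · -- same parity: `C(n,b) + C(n,a) = 0`
    have hs : (-1 : K) ^ a = (-1 : K) ^ b := by
      obtain ⟨k, hk⟩ := hab
      have e : (-1 : K) ^ a * (-1 : K) ^ b = 1 := by
        rw [← pow_add, hk, ← two_mul, pow_mul, neg_one_sq, one_pow]
      have e2 : (-1 : K) ^ b * (-1 : K) ^ b = 1 := by rw [← pow_add, ← two_mul, pow_mul, neg_one_sq, one_pow]
      linear_combination (-1 : K) ^ b * e - (-1 : K) ^ a * e2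
    rw [hs, ← mul_add] at h2
    have h3 : (n.choose b : K) + (n.choose a : K) = 0 :=
      (mul_eq_zero.mp h2).resolve_left (pow_ne_zero _ (neg_ne_zero.mpr one_ne_zero))
    have h4 : ((n.choose b + n.choose a : ℕ) : K) = 0 := by push_cast; exact h3
    have h5 := Nat.cast_eq_zero.mp h4
    omega
  · -- opposite parity: `C(n,b) = C(n,a)`, so `b ∈ {a, n - a}` — both of the parity of `a` since `n` is even
    have hs : (-1 : K) ^ a = -(-1 : K) ^ b := by
      obtain ⟨k, hk⟩ := hab
      have e : (-1 : K) ^ a * (-1 : K) ^ b = -1 := by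
        rw [← pow_add, hk, pow_succ, pow_mul, neg_one_sq, one_pow, one_mul]
      have e2 : (-1 : K) ^ b * (-1 : K) ^ b = 1 := by rw [← pow_add, ← two_mul, pow_mul, neg_one_sq, one_pow]
      linear_combination (-1 : K) ^ b * e - (-1 : K) ^ a * e2
    rw [hs, neg_mul, ← sub_eq_add_neg, ← mul_sub] at h2
    have h3 : (n.choose b : K) = (n.choose a : K) :=
      (sub_eq_zero.mp ((mul_eq_zero.mp h2).resolve_left (pow_ne_zero _ (neg_ne_zero.mpr one_ne_zero))))
    have h4 : n.choose b = n.choose a := Nat.cast_injective h3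
    rcases (choose_eq_choose_iff ha hb).mp h4 with h5 | h5
    · subst h5
      obtain ⟨k, hk⟩ := hab
      omega
    · obtain ⟨k, hk⟩ := hab
      obtain ⟨m, hm⟩ := hn
      omega

/-- **for even `n`, `ker(T_f + μ_a) = ⊥`** (`q_m = 0` for `m < n`, `q_n ≠ 0`, `a ≤ n`, `μ_a = (−1)^a C(n,a) q_n`): `T_f + μ_a` is triangular
with non-zero diagonal. [cite: BourbakiAlgebre1a3, Ch. III §8] -/
theorem ker_hankelT_add_pin_eq_bot_of_even [CharZero K] {n : ℕ} (hn : Even n) {q : ℕ → K} (hq0 : ∀ m, m < n → q m = 0)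
    (hqn : q n ≠ 0) {a : ℕ} (ha : a ≤ n) {μ : K} (hμ : μ = (-1 : K) ^ a * (n.choose a : K) * q n) :
    LinearMap.ker (Matrix.toLin' (hankelT n q) + μ • LinearMap.id) = ⊥ := by
  have hdet : (hankelT n q - (-μ) • (1 : Matrix (Fin (n + 1)) (Fin (n + 1)) K)).det ≠ 0 := by
    rw [Matrix.det_of_upperTriangular (blockTriangular_hankelT_leading_sub hq0 (-μ))]
    refine Finset.prod_ne_zero_iff.mpr fun b _ => ?_
    have hb := b.isLt
    rw [Matrix.sub_apply, Matrix.smul_apply, Matrix.one_apply_eq, smul_eq_mul, mul_one, hankelT, sub_neg_eq_add, hμ]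
    have hidx : n - (b : ℕ) + (b : ℕ) = n := by omega
    simp only [hidx]
    exact hankelT_leading_diag_add_ne_zero_of_even hn hqn ha (by omega)
  rw [Submodule.eq_bot_iff]
  intro v hv
  rw [mem_ker_toLin'_add_smul_iff] at hv
  refine Matrix.eq_zero_of_mulVec_eq_zero hdet ?_
  rw [Matrix.sub_mulVec, Matrix.smul_mulVec, Matrix.one_mulVec, hv, sub_self]

/-- **even `n`: the drop at the pin `t_a` is the geometric multiplicity of `μ_a` in `T_f`:** `dim ker(M_f − t_a) = dim ker(T_f − μ_a)`
(`q_m = 0` for `m < n`, `q_n ≠ 0`, `a ≤ n`). [cite: BourbakiAlgebre1a3, Ch. III §8] [cite: BuchweitzFlenner2008HH, Prop. 6.4.4] -/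
theorem finrank_ker_middleM_leading_pin_even [CharZero K] {n : ℕ} (hn : Even n) {q : ℕ → K} (hq0 : ∀ m, m < n → q m = 0)
    (hqn : q n ≠ 0) {a : ℕ} (ha : a ≤ n) {μ t : K} (hμ : μ = (-1 : K) ^ a * (n.choose a : K) * q n)
    (ht : t = (-1 : K) ^ n * ((n.choose a : K) * (n.choose a : K)) * (q n * q n)) :
    Module.finrank K ↥(LinearMap.ker (Matrix.toLin' (middleM n q) - t • LinearMap.id)) =
      Module.finrank K ↥(LinearMap.ker (Matrix.toLin' (hankelT n q) - μ • LinearMap.id)) := by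
  have hμ0 : μ ≠ 0 := by
    rw [hμ]
    exact mul_ne_zero (mul_ne_zero (pow_ne_zero _ (neg_ne_zero.mpr one_ne_zero))
      (Nat.cast_ne_zero.mpr (Nat.choose_pos ha).ne')) hqn
  have htμ : t = (-1 : K) ^ n * (μ * μ) := by
    rw [ht, hμ]
    have hsq : ((-1 : K) ^ a) * ((-1 : K) ^ a) = 1 := by rw [← pow_add, ← two_mul, pow_mul, neg_one_sq, one_pow]
    linear_combination (-((-1 : K) ^ n * ((n.choose a : K) * (n.choose a : K)) * (q n * q n))) * hsq
  exact finrank_ker_middleM_eq_of_ker_add_eq_bot q hμ0 htμ (ker_hankelT_add_pin_eq_bot_of_even hn hq0 hqn ha hμ)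

/-! ### The fourfold criterion (`n = 2`, pin `t = q₂²`) -/

/-- **`(T_f − q₂) v` at `n = 2`** for `q_0 = q_1 = 0`: the vector `(−2q₃v₁ + q₄v₂, −3q₂v₁ + q₃v₂, 0)`.
[cite: BourbakiAlgebre1a3, Ch. III §8] -/
theorem hankelT_two_sub_mulVec {q : ℕ → K} (hq0 : q 0 = 0) (hq1 : q 1 = 0) (v : Fin 3 → K) :
    (hankelT 2 q - q 2 • (1 : Matrix (Fin 3) (Fin 3) K)) *ᵥ v =
      ![-2 * q 3 * v 1 + q 4 * v 2, -3 * q 2 * v 1 + q 3 * v 2, 0] := by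
  ext i
  fin_cases i
  · simp [hankelT, Matrix.mulVec, dotProduct, Fin.sum_univ_three, Matrix.one_apply]
  · simp [hankelT, Matrix.mulVec, dotProduct, Fin.sum_univ_three, Matrix.one_apply, hq1]
    ring
  · simp [hankelT, Matrix.mulVec, dotProduct, Fin.sum_univ_three, Matrix.one_apply, hq0, hq1]

/-- the kernel of `T_f − q₂` at `n = 2` (`q_0 = q_1 = 0`): membership, and the bounds `1 ≤ dim ≤ 2` transported from `M_f`. -/
theorem ker_hankelT_two_pin_aux [CharZero K] {q : ℕ → K} (hq0 : q 0 = 0) (hq1 : q 1 = 0) (hq2 : q 2 ≠ 0) {t : K}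
    (ht : t = q 2 * q 2) :
    (Module.finrank K ↥(LinearMap.ker (Matrix.toLin' (middleM 2 q) - t • LinearMap.id)) =
        Module.finrank K ↥(LinearMap.ker (Matrix.toLin' (hankelT 2 q) - q 2 • LinearMap.id))) ∧
      (∀ v : Fin 3 → K, v ∈ LinearMap.ker (Matrix.toLin' (hankelT 2 q) - q 2 • LinearMap.id) ↔
        (-2 * q 3 * v 1 + q 4 * v 2 = 0 ∧ -3 * q 2 * v 1 + q 3 * v 2 = 0)) ∧
      1 ≤ Module.finrank K ↥(LinearMap.ker (Matrix.toLin' (hankelT 2 q) - q 2 • LinearMap.id)) ∧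
      Module.finrank K ↥(LinearMap.ker (Matrix.toLin' (hankelT 2 q) - q 2 • LinearMap.id)) ≤ 2 := by
  have hq0' : ∀ m, m < 2 → q m = 0 := by
    intro m hm
    interval_cases m
    · exact hq0
    · exact hq1
  have hpin : t = (-1 : K) ^ 2 * (((2 : ℕ).choose 0 : K) * ((2 : ℕ).choose 0 : K)) * (q 2 * q 2) := by
    rw [ht]; norm_num
  have hμ : q 2 = (-1 : K) ^ 0 * (((2 : ℕ).choose 0 : K)) * q 2 := by norm_num
  have heven : Even 2 := ⟨1, rfl⟩
  have heq := finrank_ker_middleM_leading_pin_even heven hq0' hq2 (a := 0) (by omega) hμ hpin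
  refine ⟨heq, fun v => ?_, ?_, ?_⟩
  · rw [toLin'_sub_smul_id, LinearMap.mem_ker, Matrix.toLin'_apply, hankelT_two_sub_mulVec hq0 hq1]
    constructor
    · intro h
      exact ⟨by simpa using congr_fun h 0, by simpa using congr_fun h 1⟩
    · rintro ⟨h1, h2⟩
      ext i
      fin_cases i
      · exact h1
      · exact h2
      · rfl
  · rw [← heq]
    exact one_le_finrank_ker_middleM_leading_pin hq0' (by omega) hpin
  · rw [← heq]
    exact finrank_ker_middleM_leading_pin_le_two hq0' hq2 (by omega) hpin

/-- **the FOURFOLD criterion, degenerate side:** `n = 2`, `q_0 = q_1 = 0`, `q_2 ≠ 0`, pin `t = q₂²` and `3q₂q₄ = 2q₃²` ⇒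
`dim ker(M_f − t) = 2` (kernel vectors `e₀` and `(0, q₃, 3q₂)` of `T_f − q₂`; the pure shape `q₃ = q₄ = 0` is included).
[cite: BourbakiAlgebre1a3, Ch. III §8] [cite: BuchweitzFlenner2008HH, Prop. 6.4.4] -/
theorem finrank_ker_middleM_leading_two_pin_of_eq [CharZero K] {q : ℕ → K} (hq0 : q 0 = 0) (hq1 : q 1 = 0) (hq2 : q 2 ≠ 0)
    {t : K} (ht : t = q 2 * q 2) (hc : 3 * q 2 * q 4 = 2 * (q 3 * q 3)) :
    Module.finrank K ↥(LinearMap.ker (Matrix.toLin' (middleM 2 q) - t • LinearMap.id)) = 2 := by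
  obtain ⟨heq, hmem, -, hle2⟩ := ker_hankelT_two_pin_aux hq0 hq1 hq2 ht
  rw [heq]
  refine le_antisymm hle2 ?_
  set W := LinearMap.ker (Matrix.toLin' (hankelT 2 q) - q 2 • LinearMap.id) with hW
  have h0 : (![1, 0, 0] : Fin 3 → K) ∈ W := (hmem _).mpr ⟨by simp, by simp⟩
  have c1 : -2 * q 3 * q 3 + q 4 * (3 * q 2) = 0 := by linear_combination hc
  have c2 : -3 * q 2 * q 3 + q 3 * (3 * q 2) = 0 := by ring
  have h1 : (![0, q 3, 3 * q 2] : Fin 3 → K) ∈ W := (hmem _).mpr ⟨by simpa using c1, by simpa using c2⟩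
  have hli0 : LinearIndependent K ![(![1, 0, 0] : Fin 3 → K), ![0, q 3, 3 * q 2]] := by
    rw [LinearIndependent.pair_iff]
    intro s r hsr
    have e0 : s = 0 := by simpa using congr_fun hsr 0
    have e2 : r * (3 * q 2) = 0 := by simpa using congr_fun hsr 2
    refine ⟨e0, ?_⟩
    rcases mul_eq_zero.mp e2 with h | h
    · exact h
    · exact absurd h (mul_ne_zero (by norm_num) hq2)
  have hli : LinearIndependent K ![(⟨_, h0⟩ : ↥W), ⟨_, h1⟩] := by
    refine LinearIndependent.of_comp W.subtype ?_
    convert hli0 using 1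
    funext i
    fin_cases i <;> rfl
  have h := hli.fintype_card_le_finrank
  rwa [Fintype.card_fin] at h

/-- **the FOURFOLD criterion, generic side:** `n = 2`, `q_0 = q_1 = 0`, `q_2 ≠ 0`, pin `t = q₂²` and `3q₂q₄ ≠ 2q₃²` ⇒
`dim ker(M_f − t) = 1` (every kernel vector of `T_f − q₂` has `v₁ = v₂ = 0`: the `2 × 2` determinant is `3q₂q₄ − 2q₃²`).
[cite: BourbakiAlgebre1a3, Ch. III §8] [cite: BuchweitzFlenner2008HH, Prop. 6.4.4] -/
theorem finrank_ker_middleM_leading_two_pin_of_ne [CharZero K] {q : ℕ → K} (hq0 : q 0 = 0) (hq1 : q 1 = 0) (hq2 : q 2 ≠ 0)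
    {t : K} (ht : t = q 2 * q 2) (hc : 3 * q 2 * q 4 ≠ 2 * (q 3 * q 3)) :
    Module.finrank K ↥(LinearMap.ker (Matrix.toLin' (middleM 2 q) - t • LinearMap.id)) = 1 := by
  obtain ⟨heq, hmem, hge1, -⟩ := ker_hankelT_two_pin_aux hq0 hq1 hq2 ht
  rw [heq]
  refine le_antisymm ?_ hge1
  set W := LinearMap.ker (Matrix.toLin' (hankelT 2 q) - q 2 • LinearMap.id) with hW
  let f : ↥W →ₗ[K] K := (LinearMap.proj (0 : Fin 3)) ∘ₗ W.subtype
  have hf : Function.Injective f := by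
    rw [← LinearMap.ker_eq_bot, LinearMap.ker_eq_bot']
    intro v hv
    have hv0 : (v : Fin 3 → K) 0 = 0 := by simpa [f] using hv
    obtain ⟨e1, e2⟩ := (hmem v).mp v.2
    have hv2 : (v : Fin 3 → K) 2 = 0 := by
      have h : (3 * q 2 * q 4 - 2 * (q 3 * q 3)) * (v : Fin 3 → K) 2 = 0 := by
        linear_combination 3 * q 2 * e1 - 2 * q 3 * e2
      rcases mul_eq_zero.mp h with h | h
      · exact absurd (sub_eq_zero.mp h) hc
      · exact h
    have hv1 : (v : Fin 3 → K) 1 = 0 := by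
      rw [hv2, mul_zero, add_zero] at e2
      rcases mul_eq_zero.mp e2 with h | h
      · exact absurd h (mul_ne_zero (by norm_num) hq2)
      · exact h
    apply Subtype.ext
    ext i
    fin_cases i
    · exact hv0
    · exact hv1
    · exact hv2
  have h := LinearMap.finrank_le_finrank_of_injective hf
  rwa [Module.finrank_self] at h

end Summit.Ventures.HSemireg.Mod4
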